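import Literature.AnabelianGeometry.SemiGraphs.TemperedVerticialMaximalCompactOfElevation
import Literature.AnabelianGeometry.SemiGraphs.TemperedReconstructionCor39aSourceNecessity
import Literature.AnabelianGeometry.SemiGraphs.TemperedEdgeLikeIsInfVerticialHolds
import HarnessLib

/-!
# [SemiAnbd] Corollary 3.9 up to twist — the ASYMMETRIC cell at EVERY pair of Cor-3.9 graphs: Thm 3.7 (iii) at
# the SOURCE gives (a), Thm 3.7 (iii) at the TARGET gives (b); each input on its own side only, and SHARP there

Mochizuki, *Semi-graphs of anabelioids*, Publ. RIMS **42** (2006), §3, Corollary 3.9 and its proof, manuscript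
pp. 42–43 (p. 42: "whose quasi-geometricity follows by 'substituting' the equivalences of Theorem 3.7, (iv), into
Definition 3.8"; p. 43 l. 13: "[again by Theorem 3.7, (iii), (iv)]") [cite: MochizukiSemiAnbd2006, Cor 3.9 pp.42-43].

PROOF-ONLY file (abc-iut cell, layer L3, seat abc-iut-w6-d064 gen 8; row «COR39-ASYMMETRIC@ALL»; no definition, no
named fact; node SemiAnbd:Cor3.9, FACT-LIST F-1710; inputs BY NAME).  The per-pair closer of record of [SemiAnbd]
Cor. 3.9 (`cor39UpToTwist_baseAt`, abc-iut-w4-d080 p418822) takes Thm. 3.7 (iii) AT BOTH graphs.  abc-iut-L3-t10's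
asymmetric cells (`cor39UpToTwistAt_asymmetric_of_isLocallyFinite` p493838, `…_of_topCyclic` p501002) showed that
clause (a) needs (iii) at the SOURCE only and clause (b) at the TARGET only — PROVIDED the (iii)-free graph satisfies
the two halves (hvm) «verticial ⇒ maximal compact» and (hei) «a nontrivial edge-like subgroup of a closed edge is the
intersection of two distinct maximal compact subgroups», which the tree had on classes (locally finite, top-cyclic).
By this seat's `isMaximalCompactSubgroup_of_exists_mem_verticialSubgroups` (p514526: verticial ⇒ maximal compact at
EVERY countable Thm-3.7 graph) and abc-iut-f-173's `edgeLikeIsInfVerticialAt_holds`, BOTH halves hold at EVERY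
Cor-3.9 graph (`hvm_of_cor39Hypotheses`, `hei_of_cor39Hypotheses`).  Hence, at EVERY pair `(G, H)` of countable
Cor-3.9 graphs of anabelioids (any underlying graphs, any groups, every pair of charts):

* `cor39a_upToTwistAt_of_compactInVerticialAt_source` — **Thm. 3.7 (iii) AT THE SOURCE `G` alone gives clause (a)**:
  a homomorphism induced up to twist by a locally open `F : G → H` is compatibly quasi-geometric;
* `cor39b_upToTwist_baseAt_of_compactInVerticialAt_target` — **Thm. 3.7 (iii) AT THE TARGET `H` alone gives clause
  (b)**: every compatibly quasi-geometric `φ` is induced up to twist by a locally open `F`, unique on underlying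
  semi-graphs;
* `cor39UpToTwistAt_asymmetric` — the cell; `cor39UpToTwist_cell_sharp` — with abc-iut-L3-t10's necessity
  witnesses (`not_forall_isLocallyFinite_cor39a`, p496623: the fold `𝒢_θ → loopGraph`; `not_forall_isLocallyFinite_cor39b…`,
  p493595 / abc-iut-f-175) **each clause needs Thm. 3.7 (iii) on ITS OWN side and only there** — the exact dependence
  of [SemiAnbd] Cor. 3.9 on Thm. 3.7 (iii) in OUR typing, for ALL pairs.

Honest framing: OUR typed `π₁^temp`, compatible reading of Def. 3.8, «induced» up to the 2-cells of Rmk. 2.4.2; the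
∀-countable typing of Cor. 3.9 is refuted as typed (p439444 / p454761) exactly because Thm. 3.7 (iii) fails at some
countable carriers; [SemiAnbd] Cor. 3.9 as printed and as used (finite dual graphs, where (iii) is a theorem) is not
claimed false; nothing here asserts abc proved or refuted; no side is taken on [IUTchIII] Cor. 3.12; typed ≠ proved.
-/

open CategoryTheory

namespace Literature.AnabelianGeometry.SemiGraphs

namespace ProfiniteSemiGraph

universe u

variable {𝒢 ℋ : ProfiniteSemiGraph.{u}}

/-! ### The two halves of Thm. 3.7 (iv) at EVERY Cor-3.9 graph, in the binder shape of the closers -/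

/-- (hvm) **«verticial ⇒ maximal compact» at every chart of EVERY countable graph satisfying the hypotheses of
Thm. 3.7** (this seat's `isMaximalCompactSubgroup_of_exists_mem_verticialSubgroups`, p514526), in the binder shape
of abc-iut-L3-t10's `_targetHalves` / `_sourceHalves` closers. [cite: MochizukiSemiAnbd2006, Thm 3.7(iv) p.41] -/
theorem hvm_of_thm37Hypotheses (h37 : 𝒢.Thm37Hypotheses) (c : TemperedPiChart 𝒢) :
    ∀ (v : 𝒢.graph.Vertex) (K : Subgroup c.G), K ∈ verticialSubgroups c v → IsMaximalCompactSubgroup K :=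
  fun v _ hK => isMaximalCompactSubgroup_of_exists_mem_verticialSubgroups h37 c ⟨v, hK⟩

/-- (hei) **«a nontrivial edge-like subgroup of a closed edge is the intersection of two distinct maximal compact
subgroups» at every chart of EVERY countable graph satisfying the hypotheses of Thm. 3.7** (abc-iut-f-173's
`edgeLikeIsInfVerticialAt_holds` + (hvm)). [cite: MochizukiSemiAnbd2006, Thm 3.7(iv) p.41] -/
theorem hei_of_thm37Hypotheses (h37 : 𝒢.Thm37Hypotheses) (c : TemperedPiChart 𝒢) :
    ∀ (e : 𝒢.graph.Edge) (L : Subgroup c.G), 𝒢.graph.IsClosedEdge e → L ∈ edgeLikeSubgroups c e →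
      L ≠ ⊥ → ∃ K₁ K₂ : Subgroup c.G, IsMaximalCompactSubgroup K₁ ∧ IsMaximalCompactSubgroup K₂ ∧
        K₁ ≠ K₂ ∧ L = K₁ ⊓ K₂ := by
  intro e L he hL hLne
  obtain ⟨v₁, v₂, H₁, H₂, hH₁, hH₂, hne, rfl⟩ := edgeLikeIsInfVerticialAt_holds 𝒢 h37 c e he L hL hLne
  exact ⟨H₁, H₂, hvm_of_thm37Hypotheses h37 c v₁ H₁ hH₁, hvm_of_thm37Hypotheses h37 c v₂ H₂ hH₂, hne, rfl⟩

/-! ### Clause (a) from Thm. 3.7 (iii) at the SOURCE — any target -/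

/-- **[SemiAnbd] Cor. 3.9 (a), up to twist, at EVERY pair from Thm. 3.7 (iii) AT THE SOURCE alone**: for countable
Cor-3.9 graphs `G`, `H` with `CompactInVerticialAt G`, every pair of charts and every locally open `F : G → H`, a
homomorphism induced up to twist by `F` is compatibly quasi-geometric.  No hypothesis on `H` beyond those of Cor. 3.9.
[cite: MochizukiSemiAnbd2006, Cor 3.9 p.42] -/
theorem cor39a_upToTwistAt_of_compactInVerticialAt_source (h𝒢iii : CompactInVerticialAt 𝒢)
    (h𝒢 : Cor39Hypotheses 𝒢) (hℋ : Cor39Hypotheses ℋ) (c𝒢 : TemperedPiChart 𝒢) (cℋ : TemperedPiChart ℋ)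
    (F : Hom 𝒢 ℋ) (hF : F.IsLocallyOpen) (φ : c𝒢.G →ₜ* cℋ.G)
    (hind : ∃ θ : F.ConjugatorFamily, Nonempty (F.chartPullbackWith θ c𝒢 cℋ ≅ BTemp.res φ)) :
    IsCompatiblyQuasiGeometric φ :=
  cor39a_upToTwistAt_of_targetHalves h𝒢iii h𝒢 hℋ c𝒢 cℋ (hvm_of_thm37Hypotheses hℋ.thm37Hypotheses cℋ)
    (hei_of_thm37Hypotheses hℋ.thm37Hypotheses cℋ) F hF φ hind

/-- The same in the named currency `Hom.InducesUpToTwist`. [cite: MochizukiSemiAnbd2006, Cor 3.9 p.42] -/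
theorem cor39a_compatUpToTwistAt_of_compactInVerticialAt_source (h𝒢iii : CompactInVerticialAt 𝒢)
    (h𝒢 : Cor39Hypotheses 𝒢) (hℋ : Cor39Hypotheses ℋ) (c𝒢 : TemperedPiChart 𝒢) (cℋ : TemperedPiChart ℋ)
    (F : Hom 𝒢 ℋ) (hF : F.IsLocallyOpen) (φ : c𝒢.G →ₜ* cℋ.G) (hind : F.InducesUpToTwist c𝒢 cℋ φ) :
    IsCompatiblyQuasiGeometric φ :=
  cor39a_upToTwistAt_of_compactInVerticialAt_source h𝒢iii h𝒢 hℋ c𝒢 cℋ F hF φ hind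

/-! ### Clause (b) from Thm. 3.7 (iii) at the TARGET — any source -/

/-- **[SemiAnbd] Cor. 3.9 (b), up to twist, at EVERY pair from Thm. 3.7 (iii) AT THE TARGET alone**: for countable
Cor-3.9 graphs `G`, `H` with `CompactInVerticialAt H` and every pair of charts, every compatibly quasi-geometric
`φ : π₁^temp(G) → π₁^temp(H)` is induced up to twist by a locally open `F : G → H`, and the underlying morphism of
semi-graphs of such an `F` is unique.  No hypothesis on `G` beyond those of Cor. 3.9.
[cite: MochizukiSemiAnbd2006, Cor 3.9 pp.42-43] -/
theorem cor39b_upToTwist_baseAt_of_compactInVerticialAt_target (hℋiii : CompactInVerticialAt ℋ)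
    (h𝒢 : Cor39Hypotheses 𝒢) (hℋ : Cor39Hypotheses ℋ) (c𝒢 : TemperedPiChart 𝒢) (cℋ : TemperedPiChart ℋ)
    (φ : c𝒢.G →ₜ* cℋ.G) (hφ : IsCompatiblyQuasiGeometric φ) :
    ∃ F : Hom 𝒢 ℋ, F.IsLocallyOpen ∧
      (∃ θ : F.ConjugatorFamily, Nonempty (F.chartPullbackWith θ c𝒢 cℋ ≅ BTemp.res φ)) ∧
      ∀ F' : Hom 𝒢 ℋ, F'.IsLocallyOpen →
        (∃ θ' : F'.ConjugatorFamily, Nonempty (F'.chartPullbackWith θ' c𝒢 cℋ ≅ BTemp.res φ)) →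
          F'.base = F.base :=
  cor39b_upToTwist_baseAt_of_sourceHalves hℋiii h𝒢 hℋ c𝒢 cℋ (hvm_of_thm37Hypotheses h𝒢.thm37Hypotheses c𝒢)
    (hei_of_thm37Hypotheses h𝒢.thm37Hypotheses c𝒢) φ hφ

/-- The same in the named currency `Hom.InducesUpToTwist`. [cite: MochizukiSemiAnbd2006, Cor 3.9 pp.42-43] -/
theorem cor39b_compatUpToTwistAt_of_compactInVerticialAt_target (hℋiii : CompactInVerticialAt ℋ)
    (h𝒢 : Cor39Hypotheses 𝒢) (hℋ : Cor39Hypotheses ℋ) (c𝒢 : TemperedPiChart 𝒢) (cℋ : TemperedPiChart ℋ)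
    (φ : c𝒢.G →ₜ* cℋ.G) (hφ : IsCompatiblyQuasiGeometric φ) :
    ∃ F : Hom 𝒢 ℋ, F.IsLocallyOpen ∧ F.InducesUpToTwist c𝒢 cℋ φ ∧
      ∀ F' : Hom 𝒢 ℋ, F'.IsLocallyOpen → F'.InducesUpToTwist c𝒢 cℋ φ → F'.base = F.base :=
  cor39b_upToTwist_baseAt_of_compactInVerticialAt_target hℋiii h𝒢 hℋ c𝒢 cℋ φ hφ

/-! ### The asymmetric cell at every pair, and its sharpness -/

/-- **[SemiAnbd] Corollary 3.9, up to twist, at EVERY pair of countable Cor-3.9 graphs — the ASYMMETRIC cell**: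
Thm. 3.7 (iii) at `𝒢` gives clause (a); Thm. 3.7 (iii) at `ℋ` gives clause (b) with full uniqueness of `F.base`.
(Class versions: `cor39UpToTwistAt_asymmetric_of_isLocallyFinite` p493838, `…_of_topCyclic` p501002; the symmetric
closer of record `cor39UpToTwist_baseAt` p418822 takes (iii) at both.) [cite: MochizukiSemiAnbd2006, Cor 3.9 pp.42-43] -/
theorem cor39UpToTwistAt_asymmetric (h𝒢 : Cor39Hypotheses 𝒢) (hℋ : Cor39Hypotheses ℋ)
    (c𝒢 : TemperedPiChart 𝒢) (cℋ : TemperedPiChart ℋ) :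
    (CompactInVerticialAt 𝒢 →
      ∀ (F : Hom 𝒢 ℋ), F.IsLocallyOpen → ∀ φ : c𝒢.G →ₜ* cℋ.G,
        (∃ θ : F.ConjugatorFamily, Nonempty (F.chartPullbackWith θ c𝒢 cℋ ≅ BTemp.res φ)) →
          IsCompatiblyQuasiGeometric φ) ∧
    (CompactInVerticialAt ℋ →
      ∀ φ : c𝒢.G →ₜ* cℋ.G, IsCompatiblyQuasiGeometric φ →
        ∃ F : Hom 𝒢 ℋ, F.IsLocallyOpen ∧
          (∃ θ : F.ConjugatorFamily, Nonempty (F.chartPullbackWith θ c𝒢 cℋ ≅ BTemp.res φ)) ∧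
          ∀ F' : Hom 𝒢 ℋ, F'.IsLocallyOpen →
            (∃ θ' : F'.ConjugatorFamily, Nonempty (F'.chartPullbackWith θ' c𝒢 cℋ ≅ BTemp.res φ)) →
              F'.base = F.base) :=
  ⟨fun h𝒢iii F hF φ hind => cor39a_upToTwistAt_of_compactInVerticialAt_source h𝒢iii h𝒢 hℋ c𝒢 cℋ F hF φ hind,
    fun hℋiii φ hφ => cor39b_upToTwist_baseAt_of_compactInVerticialAt_target hℋiii h𝒢 hℋ c𝒢 cℋ φ hφ⟩

/-- **∀-form of clause (a)**: at EVERY pair of countable Cor-3.9 graphs with Thm. 3.7 (iii) at the SOURCE, every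
homomorphism induced up to twist by a locally open morphism is compatibly quasi-geometric.
[cite: MochizukiSemiAnbd2006, Cor 3.9 p.42] -/
theorem forall_cor39a_of_compactInVerticialAt_source :
    ∀ (𝒢 ℋ : ProfiniteSemiGraph.{u}), CompactInVerticialAt 𝒢 → Cor39Hypotheses 𝒢 → Cor39Hypotheses ℋ →
      ∀ (c𝒢 : TemperedPiChart 𝒢) (cℋ : TemperedPiChart ℋ) (F : Hom 𝒢 ℋ), F.IsLocallyOpen →
        ∀ φ : c𝒢.G →ₜ* cℋ.G, F.InducesUpToTwist c𝒢 cℋ φ → IsCompatiblyQuasiGeometric φ :=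
  fun _ _ h𝒢iii h𝒢 hℋ c𝒢 cℋ F hF φ hind =>
    cor39a_compatUpToTwistAt_of_compactInVerticialAt_source h𝒢iii h𝒢 hℋ c𝒢 cℋ F hF φ hind

/-- **∀-form of clause (b)**: at EVERY pair of countable Cor-3.9 graphs with Thm. 3.7 (iii) at the TARGET, every
compatibly quasi-geometric homomorphism is induced up to twist by a locally open morphism.
[cite: MochizukiSemiAnbd2006, Cor 3.9 pp.42-43] -/
theorem forall_cor39b_of_compactInVerticialAt_target :
    ∀ (𝒢 ℋ : ProfiniteSemiGraph.{u}), CompactInVerticialAt ℋ → Cor39Hypotheses 𝒢 → Cor39Hypotheses ℋ →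
      ∀ (c𝒢 : TemperedPiChart 𝒢) (cℋ : TemperedPiChart ℋ) (φ : c𝒢.G →ₜ* cℋ.G),
        IsCompatiblyQuasiGeometric φ → ∃ F : Hom 𝒢 ℋ, F.IsLocallyOpen ∧ F.InducesUpToTwist c𝒢 cℋ φ :=
  fun _ _ hℋiii h𝒢 hℋ c𝒢 cℋ φ hφ => by
    obtain ⟨F, hF, hind, -⟩ := cor39b_compatUpToTwistAt_of_compactInVerticialAt_target hℋiii h𝒢 hℋ c𝒢 cℋ φ hφ
    exact ⟨F, hF, hind⟩

/-- **Thm. 3.7 (iii) at the TARGET does not give clause (a)** (all pairs; from abc-iut-L3-t10's locally finite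
witness `not_forall_isLocallyFinite_cor39a`, p496623 — the fold `𝒢_θ(3, k ↦ k+1) → loopGraph 3`).
[cite: MochizukiSemiAnbd2006, Cor 3.9 p.42] -/
theorem not_forall_cor39a_of_compactInVerticialAt_target :
    ¬ ∀ (𝒢 ℋ : ProfiniteSemiGraph.{0}), Cor39Hypotheses 𝒢 → Cor39Hypotheses ℋ → CompactInVerticialAt ℋ →
        ∀ (c𝒢 : TemperedPiChart 𝒢) (cℋ : TemperedPiChart ℋ) (F : Hom 𝒢 ℋ), F.IsLocallyOpen →
          ∀ φ : c𝒢.G →ₜ* cℋ.G, F.InducesUpToTwist c𝒢 cℋ φ → IsCompatiblyQuasiGeometric φ :=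
  fun h => not_forall_isLocallyFinite_cor39a fun 𝒢 ℋ _ _ h𝒢 hℋ hℋiii => h 𝒢 ℋ h𝒢 hℋ hℋiii

/-- **Thm. 3.7 (iii) at the SOURCE does not give clause (b)** (all pairs; from abc-iut-L3-t10's
`not_forall_isLocallyFinite_cor39b_of_compactInVerticialAt_source` — abc-iut-f-175's one-vertex fold into `𝒢_θ`).
[cite: MochizukiSemiAnbd2006, Cor 3.9 pp.42-43] -/
theorem not_forall_cor39b_of_compactInVerticialAt_source :
    ¬ ∀ (𝒢 ℋ : ProfiniteSemiGraph.{0}), Cor39Hypotheses 𝒢 → Cor39Hypotheses ℋ → CompactInVerticialAt 𝒢 →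
        ∀ (c𝒢 : TemperedPiChart 𝒢) (cℋ : TemperedPiChart ℋ) (φ : c𝒢.G →ₜ* cℋ.G),
          IsCompatiblyQuasiGeometric φ → ∃ F : Hom 𝒢 ℋ, F.IsLocallyOpen ∧ F.InducesUpToTwist c𝒢 cℋ φ :=
  fun h => not_forall_isLocallyFinite_cor39b_of_compactInVerticialAt_source
    fun 𝒢 ℋ _ _ h𝒢 hℋ h𝒢iii => h 𝒢 ℋ h𝒢 hℋ h𝒢iii

/-- ★ **The asymmetric cell of [SemiAnbd] Cor. 3.9 up to twist is SHARP, over ALL pairs of countable Cor-3.9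
graphs of anabelioids** (universe `0`, where the witnesses live): clause (a) holds at every pair with Thm. 3.7 (iii)
at the SOURCE and fails at some pair with (iii) at the target; clause (b) holds at every pair with (iii) at the
TARGET and fails at some pair with (iii) at the source.  Each clause needs Thm. 3.7 (iii) on its own side, and only
there. [cite: MochizukiSemiAnbd2006, Cor 3.9 pp.42-43] -/
theorem cor39UpToTwist_cell_sharp :
    ((∀ (𝒢 ℋ : ProfiniteSemiGraph.{0}), CompactInVerticialAt 𝒢 → Cor39Hypotheses 𝒢 → Cor39Hypotheses ℋ →
        ∀ (c𝒢 : TemperedPiChart 𝒢) (cℋ : TemperedPiChart ℋ) (F : Hom 𝒢 ℋ), F.IsLocallyOpen →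
          ∀ φ : c𝒢.G →ₜ* cℋ.G, F.InducesUpToTwist c𝒢 cℋ φ → IsCompatiblyQuasiGeometric φ) ∧
      ¬ ∀ (𝒢 ℋ : ProfiniteSemiGraph.{0}), Cor39Hypotheses 𝒢 → Cor39Hypotheses ℋ → CompactInVerticialAt ℋ →
        ∀ (c𝒢 : TemperedPiChart 𝒢) (cℋ : TemperedPiChart ℋ) (F : Hom 𝒢 ℋ), F.IsLocallyOpen →
          ∀ φ : c𝒢.G →ₜ* cℋ.G, F.InducesUpToTwist c𝒢 cℋ φ → IsCompatiblyQuasiGeometric φ) ∧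
    ((∀ (𝒢 ℋ : ProfiniteSemiGraph.{0}), CompactInVerticialAt ℋ → Cor39Hypotheses 𝒢 → Cor39Hypotheses ℋ →
        ∀ (c𝒢 : TemperedPiChart 𝒢) (cℋ : TemperedPiChart ℋ) (φ : c𝒢.G →ₜ* cℋ.G),
          IsCompatiblyQuasiGeometric φ → ∃ F : Hom 𝒢 ℋ, F.IsLocallyOpen ∧ F.InducesUpToTwist c𝒢 cℋ φ) ∧
      ¬ ∀ (𝒢 ℋ : ProfiniteSemiGraph.{0}), Cor39Hypotheses 𝒢 → Cor39Hypotheses ℋ → CompactInVerticialAt 𝒢 →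
        ∀ (c𝒢 : TemperedPiChart 𝒢) (cℋ : TemperedPiChart ℋ) (φ : c𝒢.G →ₜ* cℋ.G),
          IsCompatiblyQuasiGeometric φ → ∃ F : Hom 𝒢 ℋ, F.IsLocallyOpen ∧ F.InducesUpToTwist c𝒢 cℋ φ) :=
  ⟨⟨forall_cor39a_of_compactInVerticialAt_source, not_forall_cor39a_of_compactInVerticialAt_target⟩,
    ⟨forall_cor39b_of_compactInVerticialAt_target, not_forall_cor39b_of_compactInVerticialAt_source⟩⟩

end ProfiniteSemiGraph

end Literature.AnabelianGeometry.SemiGraphs
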